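import Literature.Geometry.Kaehler.TorusDolbeaultGlobalCompactness
import Mathlib.Topology.MetricSpace.Sequences
import HarnessLib

/-!
# Warner's Theorem 6.6 for `Δ_∂̄` in every degree, and on `A^{p,q}(M)`

We assemble the three degree cases of `TorusDolbeaultGlobalCompactness` with the degenerate case
`n = 0` (a compact `0`-dimensional manifold is finite, its form spaces are finite-dimensional, and
Bolzano–Weierstrass applies) into `CL2SmoothForms.dolbeaultLaplacian_compact_all`, and restrict to
the `Δ_∂̄`-invariant subspaces `A^{p,q}(M)` (`CL2SmoothForms.pq_compact`) — the compactness
hypothesis `hC` of `finrank_complexDeRham_le_sum_hodgeNumber_of_regularity_of_compactness` for a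
general Hermitian structure. F. W. Warner, GTM 94 (1983), Thm. 6.6.

## References

* F. W. Warner, GTM 94 (1983), Thm. 6.6, 6.33. [WarnerGTM94]
* C. Voisin, *Hodge Theory and Complex Algebraic Geometry I* (2002), Thm. 5.24. [VoisinHodgeI2002]
-/

noncomputable section

open scoped Manifold ContDiff Topology NNReal ENNReal RealInnerProductSpace
open Bundle Set Function Module Metric Filter Bornology
open Literature.Analysis.FunctionSpaces Literature.NumberTheory.Transcendental

set_option maxSynthPendingDepth 2

namespace Literature.Geometry.Kaehler

section Discrete

/-- A manifold modelled on a `0`-dimensional space is discrete. [folklore] -/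
theorem discreteTopology_of_finrank_zero (E : Type*) [NormedAddCommGroup E] [NormedSpace ℝ E]
    [FiniteDimensional ℝ E] {n : ℕ} [Fact (finrank ℝ E = n)] {M : Type*} [TopologicalSpace M] [ChartedSpace E M]
    (hn : n = 0) : DiscreteTopology M := by
  have hE : Subsingleton E := Module.finrank_zero_iff.1 ((Fact.out : finrank ℝ E = n).trans hn)
  rw [discreteTopology_iff_isOpen_singleton]
  intro x
  have hs : (extChartAt 𝓘(ℝ, E) x).source = {x} := by
    refine Subset.antisymm (fun y hy ↦ mem_singleton_iff.2 ?_) (singleton_subset_iff.2 (mem_extChartAt_source x))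
    exact (extChartAt 𝓘(ℝ, E) x).injOn hy (mem_extChartAt_source x) (Subsingleton.elim _ _)
  rw [← hs]
  exact isOpen_extChartAt_source x

end Discrete

variable {E : Type*} [NormedAddCommGroup E] [NormedSpace ℂ E] [FiniteDimensional ℂ E]
  {n : ℕ} [Fact (finrank ℝ E = n)] [MeasurableSpace E] [BorelSpace E]
  {M : Type*} [TopologicalSpace M] [ChartedSpace E M] [T2Space M] [CompactSpace M]
  [IsManifold 𝓘(ℂ, E) ω M] [IsManifold 𝓘(ℝ, E) ∞ M]
  [RiemannianBundle (fun x : M ↦ TangentSpace 𝓘(ℝ, E) x)]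
  [IsContMDiffRiemannianBundle 𝓘(ℝ, E) ∞ E (fun x : M ↦ TangentSpace 𝓘(ℝ, E) x)]
  (o : (x : M) → Orientation ℝ (TangentSpace 𝓘(ℝ, E) x) (Fin n)) {k m : ℕ}
  [Fact (IsSmoothForm (riemannianVolumeForm o))]

/-! ### The degenerate case `n = 0` -/

omit [IsManifold 𝓘(ℂ, E) ω M] in
/-- **On a compact `0`-dimensional manifold `A^k(M; ℂ)` is finite-dimensional.** [folklore] -/
theorem CL2SmoothForms.finiteDimensional_of_finrank_zero (hn : n = 0) (j : ℕ) :
    FiniteDimensional ℂ (CL2SmoothForms o j) := by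
  haveI : DiscreteTopology M := discreteTopology_of_finrank_zero E (n := n) hn
  haveI : Finite M := finite_of_compact_of_discrete
  haveI : ∀ x : M, Module.Finite ℂ (TangentSpace 𝓘(ℝ, E) x [⋀^Fin j]→L[ℝ] ℂ) := fun _ ↦
    finiteDimensional_complex_covectors E j
  exact Module.Finite.of_injective (CL2SmoothForms.toFormₗ o (k := j))
    fun α β h ↦ (CL2SmoothForms.toForm_inj o).1 h

omit [IsManifold 𝓘(ℂ, E) ω M] in
/-- In dimension `0` every bounded sequence of `A^k(M; ℂ)` has a Cauchy subsequence
(Bolzano–Weierstrass in a finite-dimensional space). [folklore] -/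
theorem CL2SmoothForms.exists_subseq_cauchySeq_of_finrank_zero (hn : n = 0) {j : ℕ}
    (u : ℕ → CL2SmoothForms o j) (c : ℝ) (hb : ∀ i, ‖u i‖ ≤ c) :
    ∃ ψ : ℕ → ℕ, StrictMono ψ ∧ CauchySeq (u ∘ ψ) := by
  haveI := CL2SmoothForms.finiteDimensional_of_finrank_zero o hn j
  haveI : ProperSpace (CL2SmoothForms o j) := FiniteDimensional.proper ℂ _
  obtain ⟨a, -, ψ, hψ, hlim⟩ := tendsto_subseq_of_bounded (isBounded_closedBall (x := (0 : CL2SmoothForms o j)) (r := c))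
    (x := u) fun i ↦ by simpa using hb i
  exact ⟨ψ, hψ, hlim.cauchySeq⟩

/-! ### All degrees -/

/-- **Warner's Theorem 6.6 for `Δ_∂̄` in every degree** `K + m = n` (Hermitian metric): a sequence in
`A^K(M; ℂ)` with `‖u_i‖` and `‖Δ_∂̄ u_i‖` bounded has an `L²`-Cauchy subsequence.
[cite: WarnerGTM94, Thm. 6.6] -/
theorem CL2SmoothForms.dolbeaultLaplacian_compact_all
    (hH : ∀ (x : M) (v w : TangentSpace 𝓘(ℝ, E) x), ⟪tangentJ E x v, tangentJ E x w⟫ = ⟪v, w⟫) :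
    ∀ (K m : ℕ) (h : K + m = n) (u : ℕ → CL2SmoothForms o K) (c : ℝ), (∀ i, ‖u i‖ ≤ c) →
      (∀ i, ‖CL2SmoothForms.dolbeaultLaplacian o h (u i)‖ ≤ c) →
        ∃ ψ : ℕ → ℕ, StrictMono ψ ∧ CauchySeq (u ∘ ψ)
  | 0, 0, h, u, c, hb, _ => CL2SmoothForms.exists_subseq_cauchySeq_of_finrank_zero o (by omega) u c hb
  | 0, m + 1, h, u, c, hb, hΔ => CL2SmoothForms.dolbeaultLaplacian_compact_zero o hH h u c hb hΔ
  | K + 1, 0, h, u, c, hb, hΔ => CL2SmoothForms.dolbeaultLaplacian_compact_top o hH h u c hb hΔ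
  | K + 1, m + 1, h, u, c, hb, hΔ => CL2SmoothForms.dolbeaultLaplacian_compact o hH h u c hb hΔ

/-- **Warner's Theorem 6.6 for `Δ_∂̄` on `A^{p,q}(M)`**: a sequence in `A^{p,q}(M)` with `‖u_i‖` and
`‖Δ_∂̄ u_i‖` bounded has an `L²`-Cauchy subsequence — the compactness hypothesis `hC` of the
elliptic reduction of the Frölicher inequality. [cite: WarnerGTM94, Thm. 6.6] -/
theorem CL2SmoothForms.pq_compact
    (hH : ∀ (x : M) (v w : TangentSpace 𝓘(ℝ, E) x), ⟪tangentJ E x v, tangentJ E x w⟫ = ⟪v, w⟫)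
    (p q : ℕ) (h : (p + q) + m = n) (u : ℕ → CL2SmoothForms.pq o p q) (c : ℝ) (hb : ∀ i, ‖u i‖ ≤ c)
    (hΔ : ∀ i, ‖CL2SmoothForms.pqLaplacian o hH p q h (u i)‖ ≤ c) :
    ∃ ψ : ℕ → ℕ, StrictMono ψ ∧ CauchySeq (u ∘ ψ) := by
  obtain ⟨ψ, hψ, hC⟩ := CL2SmoothForms.dolbeaultLaplacian_compact_all o hH (p + q) m h
    (fun i ↦ (u i : CL2SmoothForms o (p + q))) c (fun i ↦ hb i)
    (fun i ↦ by
      have : CL2SmoothForms.dolbeaultLaplacian o h (u i : CL2SmoothForms o (p + q)) =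
          ((CL2SmoothForms.pqLaplacian o hH p q h (u i) : CL2SmoothForms.pq o p q) : CL2SmoothForms o (p + q)) := rfl
      rw [this]
      exact hΔ i)
  refine ⟨ψ, hψ, ?_⟩
  rw [Metric.cauchySeq_iff] at hC ⊢
  intro ε hε
  obtain ⟨N, hN⟩ := hC ε hε
  refine ⟨N, fun i hi j hj ↦ ?_⟩
  have := hN i hi j hj
  rwa [Function.comp_apply, Function.comp_apply, Subtype.dist_eq] 

end Literature.Geometry.Kaehler
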